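import Summits.BirchSwinnertonDyer.BirchSwinnertonDyer.Theorems.CyclotomicUntwistGNineCubicFrobeniusTraceTools
import HarnessLib

/-!
# LAW L-a3 (N) over `ℚ(ζ₉)`, cubic level: for EVERY integer cubic `y² = x³ + Ax² + Bx + C` with
# `3 ∣ A` and `3`-adic-square discriminant (the GNineCriterion hypotheses, plus the Kodaira-IV/II*
# signature `3⁵ ∥ P` / `3⁸ ∥ P`) the trace of Frobenius at `w ∣ 3` IS the closed form `psUntwistedTrace`
# (route `CyclotomicUntwist`, cruxes K1 `PSRankOneLowerHalfAtThree` / K2 `PSRankOneUpperHalfAtThree`)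

Cell `pub/bsd-wall` (D-0145 line `route-BirchSwinnertonDyer-CyclotomicUntwist`), seat `bsd-line-cycu-p3`
(gen 7). Helper toward K1 (stmt-BirchSwinnertonDyer-21580) / K2 (21581). THEOREMS ONLY (no definition, no
named fact, no `sorry`); BSD is not proved by this file and no crux is. Route-independent (no `Theses` import:
good reduction is re-derived from the leaves rather than imported from `GNineCriterion`).

The reduction of cycu-p2's `GNineCriterion` (cusp translation `exists_translate_three_dvd`; residue patterns
`pattern_four` / `pattern_six` / `pattern_high`; the `√−3`-rescaling for `v₃(disc) ≥ 8`) is run with BOTH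
sides carried along (tools file `…CubicFrobeniusTraceTools`), down to the two leaf families where
`CyclotomicUntwistGNineLeafFrobeniusTrace` identifies `a_w` with (N′):

* `good_and_frobeniusTraceAt_of_pattern_four` / `_of_pattern_six` — the leaves in pattern currency;
* `good_and_frobeniusTraceAt_of_translate` / `_of_twist` — transport back along the two changes of variables;
* **`good_and_frobeniusTraceAt_cubic_low`** (`1 ≤ v ≤ 7`), **`good_and_frobeniusTraceAt_cubic`** (`1 ≤ v ≤ 13`,
  `27 ∣ A² − 3B` if `v ≥ 8`, `3⁵ ∥ P` if `v = 6`, `3⁸ ∥ P` if `v = 12`, `P = 2A³ − 9AB + 27C`): for `F ∋ ζ₉`,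
  `w ∋ 3` with `#k_w = 3`, the cubic has good reduction at `w` AND
  **`a_w(y² = x³ + Ax² + Bx + C) = psUntwistedTrace`** of the same cubic over `ℚ`
  (`frobeniusTraceAt_cubic_eq_psUntwistedTrace`). The I₀*-shaped branch of `pattern_six` is excluded by
  `3⁵ ∥ P` (`false_of_IzeroStar_shape`).

References: J. Tate, LNM 476 (1975) §7 [Tate1975]; A. Kraus, Manuscripta Math. 69 (1990), Théorème (p = 3)
[Kraus1990]; J. H. Silverman, *AEC* III.1, VII.1 Prop. 1.3(b), C.§16 [SilvermanAEC2009].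
-/

-- single-conjunct summit: `Summit.BirchSwinnertonDyer.BirchSwinnertonDyer.…` repeats the name by design
set_option linter.dupNamespace false
set_option autoImplicit false

noncomputable section

open scoped NumberField Classical

open IsDedekindDomain IsDedekindDomain.HeightOneSpectrum NumberField WeierstrassCurve WithZero
  Literature.NumberTheory.EllipticCurves
  Summit.BirchSwinnertonDyer.BirchSwinnertonDyer.Theorems.GNine
  Summit.BirchSwinnertonDyer.BirchSwinnertonDyer.Theorems.GNineCriterion

namespace Summit.BirchSwinnertonDyer.BirchSwinnertonDyer.Theorems.GNineFrobeniusTrace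

section FSide

variable {F : Type} [Field F] [NumberField F] {ζ : F} (w : HeightOneSpectrum (𝓞 F))

/-! ### The leaves in `GNineCriterion`'s pattern currency -/

/-- Leaf II in pattern form: `(A, B, C) = (3ε + 9α', 9β', −3ε + 9γ')`, `ε = ±1` — good reduction and
the trace identity. [cite: Kraus1990, Théorème (p = 3)] -/
theorem good_and_frobeniusTraceAt_of_pattern_four (hζ : IsPrimitiveRoot ζ 9)
    (hw : (3 : 𝓞 F) ∈ w.asIdeal) (hq : Nat.card (𝓞 F ⧸ w.asIdeal) = 3)
    (A B C ε α' β' γ' : ℤ) (hε : ε = 1 ∨ ε = -1)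
    (hA : A = 3 * ε + 9 * α') (hB : B = 9 * β') (hC : C = -3 * ε + 9 * γ') :
    (⟨0, (A : F), 0, (B : F), (C : F)⟩ : WeierstrassCurve F).HasGoodReductionAt w ∧
    (⟨0, (A : F), 0, (B : F), (C : F)⟩ : WeierstrassCurve F).frobeniusTraceAt w =
      ((⟨0, A, 0, B, C⟩ : WeierstrassCurve ℤ).map (Int.castRingHom ℚ)).psUntwistedTrace := by
  have hg : (-ε) ^ 2 = 1 := by rcases hε with rfl | rfl <;> norm_num
  have hA' : A = 3 * (3 * α' - -ε) := by rw [hA]; ring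
  have hB' : B = 9 * β' := hB
  have hC' : C = 3 * (3 * γ' + -ε) := by rw [hC]; ring
  subst hA' hB' hC'
  exact ⟨hasGoodReductionAt_leafII w hζ hw α' β' γ' (-ε) hg,
    frobeniusTraceAt_leafII_eq_psUntwistedTrace w α' β' γ' hζ hw hq hg⟩

/-- Leaf IV in pattern form: `(A, B, C) = (9α₁, −9 + 27β₂, −9ε + 27γ₂)`, `ε = ±1` — good reduction and
the trace identity. [cite: Kraus1990, Théorème (p = 3)] -/
theorem good_and_frobeniusTraceAt_of_pattern_six (hζ : IsPrimitiveRoot ζ 9)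
    (hw : (3 : 𝓞 F) ∈ w.asIdeal) (hq : Nat.card (𝓞 F ⧸ w.asIdeal) = 3)
    (A B C ε α₁ β₂ γ₂ : ℤ) (hε : ε = 1 ∨ ε = -1)
    (hA : A = 9 * α₁) (hB : B = -9 + 27 * β₂) (hC : C = -9 * ε + 27 * γ₂) :
    (⟨0, (A : F), 0, (B : F), (C : F)⟩ : WeierstrassCurve F).HasGoodReductionAt w ∧
    (⟨0, (A : F), 0, (B : F), (C : F)⟩ : WeierstrassCurve F).frobeniusTraceAt w =
      ((⟨0, A, 0, B, C⟩ : WeierstrassCurve ℤ).map (Int.castRingHom ℚ)).psUntwistedTrace := by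
  have hg : (-ε) ^ 2 = 1 := by rcases hε with rfl | rfl <;> norm_num
  have hA' : A = 9 * α₁ := hA
  have hB' : B = 9 * (3 * β₂ - 1) := by rw [hB]; ring
  have hC' : C = 9 * (3 * γ₂ + -ε) := by rw [hC]; ring
  subst hA' hB' hC'
  exact ⟨hasGoodReductionAt_leafIV w hζ hw α₁ β₂ γ₂ (-ε) hg,
    frobeniusTraceAt_leafIV_eq_psUntwistedTrace w α₁ β₂ γ₂ hζ hw hq hg⟩

/-- Transport of «good reduction ∧ trace identity» back along the cusp translation.
[cite: SilvermanAEC2009, VII.1 Prop. 1.3(b)] -/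
theorem good_and_frobeniusTraceAt_of_translate (A B C t : ℤ) (hΔ : (⟨0, A, 0, B, C⟩ : WeierstrassCurve ℤ).Δ ≠ 0)
    (h : (⟨0, ((A + 3 * t : ℤ) : F), 0, ((B + 2 * t * A + 3 * t ^ 2 : ℤ) : F),
        ((C + t * B + t ^ 2 * A + t ^ 3 : ℤ) : F)⟩ : WeierstrassCurve F).HasGoodReductionAt w ∧
      (⟨0, ((A + 3 * t : ℤ) : F), 0, ((B + 2 * t * A + 3 * t ^ 2 : ℤ) : F),
        ((C + t * B + t ^ 2 * A + t ^ 3 : ℤ) : F)⟩ : WeierstrassCurve F).frobeniusTraceAt w =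
      ((⟨0, A + 3 * t, 0, B + 2 * t * A + 3 * t ^ 2, C + t * B + t ^ 2 * A + t ^ 3⟩ : WeierstrassCurve ℤ).map
        (Int.castRingHom ℚ)).psUntwistedTrace) :
    (⟨0, (A : F), 0, (B : F), (C : F)⟩ : WeierstrassCurve F).HasGoodReductionAt w ∧
    (⟨0, (A : F), 0, (B : F), (C : F)⟩ : WeierstrassCurve F).frobeniusTraceAt w =
      ((⟨0, A, 0, B, C⟩ : WeierstrassCurve ℤ).map (Int.castRingHom ℚ)).psUntwistedTrace := by
  have e : (⟨0, ((A + 3 * t : ℤ) : F), 0, ((B + 2 * t * A + 3 * t ^ 2 : ℤ) : F),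
      ((C + t * B + t ^ 2 * A + t ^ 3 : ℤ) : F)⟩ : WeierstrassCurve F) =
      ⟨0, (A : F) + 3 * (t : F), 0, (B : F) + 2 * (t : F) * (A : F) + 3 * (t : F) ^ 2,
        (C : F) + (t : F) * (B : F) + (t : F) ^ 2 * (A : F) + (t : F) ^ 3⟩ := by
    ext <;> push_cast <;> ring
  have hgood : (⟨0, (A : F), 0, (B : F), (C : F)⟩ : WeierstrassCurve F).HasGoodReductionAt w := by
    rw [GNineCriterion.hasGoodReductionAt_iff_translate w (A : F) (B : F) (C : F) (t : F), ← e]; exact h.1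
  refine ⟨hgood, ?_⟩
  rw [← frobeniusTraceAt_cubic_translate w A B C t hΔ hgood, ← psUntwistedTrace_cubic_translate A B C t hΔ]
  exact h.2

/-- Transport of «good reduction ∧ trace identity» back along the `√−3`-rescaling.
[cite: SilvermanAEC2009, VII.1 Prop. 1.3(b)] -/
theorem good_and_frobeniusTraceAt_of_twist (hζ : IsPrimitiveRoot ζ 9) (a b c : ℤ)
    (hΔ : (⟨0, 9 * a, 0, 27 * b, 27 * c⟩ : WeierstrassCurve ℤ).Δ ≠ 0)
    (hΔ' : (⟨0, -(3 * a), 0, 3 * b, -c⟩ : WeierstrassCurve ℤ).Δ ≠ 0)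
    (h : (⟨0, ((-(3 * a) : ℤ) : F), 0, ((3 * b : ℤ) : F), ((-c : ℤ) : F)⟩ : WeierstrassCurve F).HasGoodReductionAt w ∧
      (⟨0, ((-(3 * a) : ℤ) : F), 0, ((3 * b : ℤ) : F), ((-c : ℤ) : F)⟩ : WeierstrassCurve F).frobeniusTraceAt w =
      ((⟨0, -(3 * a), 0, 3 * b, -c⟩ : WeierstrassCurve ℤ).map (Int.castRingHom ℚ)).psUntwistedTrace) :
    (⟨0, ((9 * a : ℤ) : F), 0, ((27 * b : ℤ) : F), ((27 * c : ℤ) : F)⟩ : WeierstrassCurve F).HasGoodReductionAt w ∧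
    (⟨0, ((9 * a : ℤ) : F), 0, ((27 * b : ℤ) : F), ((27 * c : ℤ) : F)⟩ : WeierstrassCurve F).frobeniusTraceAt w =
      ((⟨0, 9 * a, 0, 27 * b, 27 * c⟩ : WeierstrassCurve ℤ).map (Int.castRingHom ℚ)).psUntwistedTrace := by
  have hgood : (⟨0, ((9 * a : ℤ) : F), 0, ((27 * b : ℤ) : F), ((27 * c : ℤ) : F)⟩ :
      WeierstrassCurve F).HasGoodReductionAt w := by
    have h' := hasGoodReductionAt_cubic_int_of_twist w hζ (3 * a) (3 * b) c h.1
    have e : (⟨0, ((3 * (3 * a) : ℤ) : F), 0, ((9 * (3 * b) : ℤ) : F), ((27 * c : ℤ) : F)⟩ : WeierstrassCurve F) =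
        ⟨0, ((9 * a : ℤ) : F), 0, ((27 * b : ℤ) : F), ((27 * c : ℤ) : F)⟩ := by
      ext <;> push_cast <;> ring
    rw [← e]; exact h'
  refine ⟨hgood, ?_⟩
  rw [frobeniusTraceAt_cubic_twist w hζ a b c hΔ hgood, psUntwistedTrace_cubic_twist a b c hΔ']
  exact h.2

/-! ### The cubic-level law -/

variable (hζ : IsPrimitiveRoot ζ 9) (hw : (3 : 𝓞 F) ∈ w.asIdeal) (hq : Nat.card (𝓞 F ⧸ w.asIdeal) = 3)

include hζ hw hq in
/-- **Low discriminant valuation (`1 ≤ v ≤ 7`).** For an integer cubic with `3 ∣ A`, `disc = 3^v·d`,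
`d ≡ 1 (mod 3)`, `v` even, and `3⁵ ∥ P` if `v = 6` (`P = 2A³ − 9AB + 27C`): at a place `w ∋ 3` of `F ∋ ζ₉` with
`#k_w = 3`, the cubic has good reduction at `w` and `a_w(y² = x³ + Ax² + Bx + C) = psUntwistedTrace` of the
same cubic over `ℚ`. After the cusp translation, `v = 4` is leaf II and `v = 6` is leaf IV (the I₀*-shaped
branch being excluded by `3⁵ ∥ P`). [cite: Kraus1990, Théorème (p = 3)] [cite: SilvermanAEC2009, C.§16] -/
theorem good_and_frobeniusTraceAt_cubic_low (A B C : ℤ) (v : ℕ) (d : ℤ) (h3A : (3 : ℤ) ∣ A)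
    (hD : A ^ 2 * B ^ 2 - 4 * B ^ 3 - 4 * A ^ 3 * C - 27 * C ^ 2 + 18 * A * B * C = 3 ^ v * d)
    (hd : d % 3 = 1) (hv : Even v) (hv1 : 1 ≤ v) (hv7 : v ≤ 7)
    (hP : v = 6 → (3 : ℤ) ^ 5 ∣ 2 * A ^ 3 - 9 * A * B + 27 * C ∧ ¬ (3 : ℤ) ^ 6 ∣ 2 * A ^ 3 - 9 * A * B + 27 * C) :
    (⟨0, (A : F), 0, (B : F), (C : F)⟩ : WeierstrassCurve F).HasGoodReductionAt w ∧
    (⟨0, (A : F), 0, (B : F), (C : F)⟩ : WeierstrassCurve F).frobeniusTraceAt w =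
      ((⟨0, A, 0, B, C⟩ : WeierstrassCurve ℤ).map (Int.castRingHom ℚ)).psUntwistedTrace := by
  have hΔ0 : (⟨0, A, 0, B, C⟩ : WeierstrassCurve ℤ).Δ ≠ 0 := cubic_int_Δ_ne_zero hD hd
  have h3D : (3 : ℤ) ∣ A ^ 2 * B ^ 2 - 4 * B ^ 3 - 4 * A ^ 3 * C - 27 * C ^ 2 + 18 * A * B * C := by
    rw [hD]; exact dvd_mul_of_dvd_left (dvd_pow_self 3 (by omega)) d
  obtain ⟨t, htA, htB, htC⟩ := exists_translate_three_dvd A B C h3A h3D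
  refine good_and_frobeniusTraceAt_of_translate w A B C t hΔ0 ?_
  set A' : ℤ := A + 3 * t with hA'
  set B' : ℤ := B + 2 * t * A + 3 * t ^ 2 with hB'
  set C' : ℤ := C + t * B + t ^ 2 * A + t ^ 3 with hC'
  have hD' : A' ^ 2 * B' ^ 2 - 4 * B' ^ 3 - 4 * A' ^ 3 * C' - 27 * C' ^ 2 + 18 * A' * B' * C' =
      3 ^ v * d := by rw [hA', hB', hC', disc_translate, hD]
  have hP' : 2 * A' ^ 3 - 9 * A' * B' + 27 * C' = 2 * A ^ 3 - 9 * A * B + 27 * C := by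
    rw [hA', hB', hC', csix_translate]
  obtain ⟨a, ha⟩ := htA
  obtain ⟨b, hb⟩ := htB
  obtain ⟨c, hc⟩ := htC
  have h27 : (27 : ℤ) ∣ 3 ^ v * d := by
    rw [← hD', ha, hb, hc, disc_eq_of_three_dvd]; exact dvd_mul_right 27 _
  have hv46 : v = 4 ∨ v = 6 := by obtain ⟨k, hk⟩ := hv; interval_cases v <;> omega
  clear_value A' B' C'
  rcases hv46 with rfl | rfl
  · obtain ⟨ε, α', β', γ', hε, h1, h2, h3'⟩ :=
      pattern_four A' B' C' d ⟨a, ha⟩ ⟨b, hb⟩ ⟨c, hc⟩ (by linarith) hd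
    exact good_and_frobeniusTraceAt_of_pattern_four w hζ hw hq A' B' C' ε α' β' γ' hε h1 h2 h3'
  · rcases pattern_six A' B' C' d ⟨a, ha⟩ ⟨b, hb⟩ ⟨c, hc⟩ (by linarith) hd with
      ⟨a₁, b₁, c₁, h1, h2, h3'⟩ | ⟨ε, α₁, β₂, γ₂, hε, h1, h2, h3'⟩
    · -- the I₀*-shaped branch: excluded by `3⁵ ∥ P`
      exfalso
      obtain ⟨h5, h6⟩ := hP rfl
      rw [← hP', h1, h2, h3'] at h5 h6
      exact false_of_IzeroStar_shape a₁ b₁ c₁ h5 h6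
    · exact good_and_frobeniusTraceAt_of_pattern_six w hζ hw hq A' B' C' ε α₁ β₂ γ₂ hε h1 h2 h3'

include hζ hw hq in
/-- **The cubic-level law.** For an integer cubic with `3 ∣ A`, `disc = 3^v·d`, `d ≡ 1 (mod 3)`, `v` even,
`1 ≤ v ≤ 13`, `27 ∣ A² − 3B` whenever `v ≥ 8` (potentially good reduction), `3⁵ ∥ P` if `v = 6` and
`3⁸ ∥ P` if `v = 12` (`P = 2A³ − 9AB + 27C`; the Kodaira IV / II* signature): at a place `w ∋ 3` of
`F ∋ ζ₉` with `#k_w = 3`, the cubic has good reduction at `w` and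
**`a_w(y² = x³ + Ax² + Bx + C) = psUntwistedTrace`** of the same cubic over `ℚ`. For `v ≥ 8` the pattern
`9 ∣ A, 27 ∣ B, 27 ∣ C` makes the `√−3`-rescaling integral with `v` lowered by `6`; it is an `F`-isomorphism
(so `a_w` is unchanged) and multiplies `(c₆, Δ)` by `((−3)³, 3⁶)` (so (N′) is unchanged, p621340).
[cite: Kraus1990, Théorème (p = 3)] [cite: SilvermanAEC2009, VII.1 Prop. 1.3(b) and C.§16] -/
theorem good_and_frobeniusTraceAt_cubic (A B C : ℤ) (v : ℕ) (d : ℤ) (h3A : (3 : ℤ) ∣ A)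
    (hD : A ^ 2 * B ^ 2 - 4 * B ^ 3 - 4 * A ^ 3 * C - 27 * C ^ 2 + 18 * A * B * C = 3 ^ v * d)
    (hd : d % 3 = 1) (hv : Even v) (hv1 : 1 ≤ v) (hv13 : v ≤ 13)
    (hc4 : 8 ≤ v → (27 : ℤ) ∣ A ^ 2 - 3 * B)
    (hP6 : v = 6 → (3 : ℤ) ^ 5 ∣ 2 * A ^ 3 - 9 * A * B + 27 * C ∧ ¬ (3 : ℤ) ^ 6 ∣ 2 * A ^ 3 - 9 * A * B + 27 * C)
    (hP12 : v = 12 → (3 : ℤ) ^ 8 ∣ 2 * A ^ 3 - 9 * A * B + 27 * C ∧ ¬ (3 : ℤ) ^ 9 ∣ 2 * A ^ 3 - 9 * A * B + 27 * C) :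
    (⟨0, (A : F), 0, (B : F), (C : F)⟩ : WeierstrassCurve F).HasGoodReductionAt w ∧
    (⟨0, (A : F), 0, (B : F), (C : F)⟩ : WeierstrassCurve F).frobeniusTraceAt w =
      ((⟨0, A, 0, B, C⟩ : WeierstrassCurve ℤ).map (Int.castRingHom ℚ)).psUntwistedTrace := by
  by_cases hv7 : v ≤ 7
  · exact good_and_frobeniusTraceAt_cubic_low w hζ hw hq A B C v d h3A hD hd hv hv1 hv7 hP6
  have hv8 : 8 ≤ v := by omega
  have hΔ0 : (⟨0, A, 0, B, C⟩ : WeierstrassCurve ℤ).Δ ≠ 0 := cubic_int_Δ_ne_zero hD hd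
  have h3D : (3 : ℤ) ∣ A ^ 2 * B ^ 2 - 4 * B ^ 3 - 4 * A ^ 3 * C - 27 * C ^ 2 + 18 * A * B * C := by
    rw [hD]; exact dvd_mul_of_dvd_left (dvd_pow_self 3 (by omega)) d
  obtain ⟨t, htA, htB, htC⟩ := exists_translate_three_dvd A B C h3A h3D
  refine good_and_frobeniusTraceAt_of_translate w A B C t hΔ0 ?_
  set A' : ℤ := A + 3 * t with hA'
  set B' : ℤ := B + 2 * t * A + 3 * t ^ 2 with hB'
  set C' : ℤ := C + t * B + t ^ 2 * A + t ^ 3 with hC'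
  have hD' : A' ^ 2 * B' ^ 2 - 4 * B' ^ 3 - 4 * A' ^ 3 * C' - 27 * C' ^ 2 + 18 * A' * B' * C' =
      3 ^ v * d := by rw [hA', hB', hC', disc_translate, hD]
  have hP' : 2 * A' ^ 3 - 9 * A' * B' + 27 * C' = 2 * A ^ 3 - 9 * A * B + 27 * C := by
    rw [hA', hB', hC', csix_translate]
  have hc4' : (27 : ℤ) ∣ A' ^ 2 - 3 * B' := by rw [hA', hB', csub_translate]; exact hc4 hv8
  have h8 : (3 : ℤ) ^ 8 ∣ A' ^ 2 * B' ^ 2 - 4 * B' ^ 3 - 4 * A' ^ 3 * C' - 27 * C' ^ 2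
      + 18 * A' * B' * C' := by
    rw [hD']; exact dvd_mul_of_dvd_left (pow_dvd_pow 3 hv8) d
  have hΔ0' : (⟨0, A', 0, B', C'⟩ : WeierstrassCurve ℤ).Δ ≠ 0 := cubic_int_Δ_ne_zero hD' hd
  obtain ⟨a, b, c, h1, h2, h3'⟩ := pattern_high A' B' C' htA htB htC h8 hc4'
  clear_value A' B' C'
  subst h1 h2 h3'
  -- the twisted cubic: `disc'' = 3^(v−6) d`
  obtain ⟨m, hm⟩ : ∃ m : ℕ, v = m + 6 := ⟨v - 6, by omega⟩
  have hDtw : (-(3 * a)) ^ 2 * (3 * b) ^ 2 - 4 * (3 * b) ^ 3 - 4 * (-(3 * a)) ^ 3 * (-c)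
      - 27 * (-c) ^ 2 + 18 * (-(3 * a)) * (3 * b) * (-c) = 3 ^ m * d := by
    have key := disc_twist a b c
    rw [hD', hm, pow_add] at key
    have h36 : (3 : ℤ) ^ 6 ≠ 0 := by norm_num
    apply mul_right_cancel₀ h36
    linarith
  have hΔtw : (⟨0, -(3 * a), 0, 3 * b, -c⟩ : WeierstrassCurve ℤ).Δ ≠ 0 := cubic_int_Δ_ne_zero hDtw hd
  refine good_and_frobeniusTraceAt_of_twist w hζ a b c hΔ0' hΔtw ?_
  have hmeven : Even m := by obtain ⟨k, hk⟩ := hv; exact ⟨k - 3, by omega⟩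
  refine good_and_frobeniusTraceAt_cubic_low w hζ hw hq (-(3 * a)) (3 * b) (-c) m d
    ⟨-a, by ring⟩ hDtw hd hmeven (by omega) (by omega) fun hm6 ↦ ?_
  -- `3⁸ ∥ P(9a, 27b, 27c) = −27·P(−3a, 3b, −c)` ⟹ `3⁵ ∥ P(−3a, 3b, −c)`
  have hv12 : v = 12 := by omega
  obtain ⟨h8P, h9P⟩ := hP12 hv12
  rw [← hP', csix_twist] at h8P h9P
  have h27 : (3 : ℤ) ^ 3 ≠ 0 := by norm_num
  constructor
  · have h' : (3 : ℤ) ^ 3 * 3 ^ 5 ∣ (3 : ℤ) ^ 3 *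
        -(2 * (-(3 * a)) ^ 3 - 9 * (-(3 * a)) * (3 * b) + 27 * (-c)) := by
      have e : (3 : ℤ) ^ 3 * -(2 * (-(3 * a)) ^ 3 - 9 * (-(3 * a)) * (3 * b) + 27 * (-c)) =
          -27 * (2 * (-(3 * a)) ^ 3 - 9 * (-(3 * a)) * (3 * b) + 27 * (-c)) := by ring
      rw [e, ← pow_add]; exact h8P
    exact (dvd_neg.mp ((mul_dvd_mul_iff_left h27).mp h'))
  · intro h6
    apply h9P
    have e : -27 * (2 * (-(3 * a)) ^ 3 - 9 * (-(3 * a)) * (3 * b) + 27 * (-c)) =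
        (3 : ℤ) ^ 3 * -(2 * (-(3 * a)) ^ 3 - 9 * (-(3 * a)) * (3 * b) + 27 * (-c)) := by ring
    rw [e, show (9 : ℕ) = 3 + 6 from rfl, pow_add]
    exact mul_dvd_mul_left _ (dvd_neg.mpr h6)

include hζ hw hq in
/-- **`a_w = psUntwistedTrace` at the cubic level** (second component of `good_and_frobeniusTraceAt_cubic`).
[cite: Kraus1990, Théorème (p = 3)] [cite: SilvermanAEC2009, C.§16] -/
theorem frobeniusTraceAt_cubic_eq_psUntwistedTrace (A B C : ℤ) (v : ℕ) (d : ℤ) (h3A : (3 : ℤ) ∣ A)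
    (hD : A ^ 2 * B ^ 2 - 4 * B ^ 3 - 4 * A ^ 3 * C - 27 * C ^ 2 + 18 * A * B * C = 3 ^ v * d)
    (hd : d % 3 = 1) (hv : Even v) (hv1 : 1 ≤ v) (hv13 : v ≤ 13)
    (hc4 : 8 ≤ v → (27 : ℤ) ∣ A ^ 2 - 3 * B)
    (hP6 : v = 6 → (3 : ℤ) ^ 5 ∣ 2 * A ^ 3 - 9 * A * B + 27 * C ∧ ¬ (3 : ℤ) ^ 6 ∣ 2 * A ^ 3 - 9 * A * B + 27 * C)
    (hP12 : v = 12 → (3 : ℤ) ^ 8 ∣ 2 * A ^ 3 - 9 * A * B + 27 * C ∧ ¬ (3 : ℤ) ^ 9 ∣ 2 * A ^ 3 - 9 * A * B + 27 * C) :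
    (⟨0, (A : F), 0, (B : F), (C : F)⟩ : WeierstrassCurve F).frobeniusTraceAt w =
      ((⟨0, A, 0, B, C⟩ : WeierstrassCurve ℤ).map (Int.castRingHom ℚ)).psUntwistedTrace :=
  (good_and_frobeniusTraceAt_cubic w hζ hw hq A B C v d h3A hD hd hv hv1 hv13 hc4 hP6 hP12).2

end FSide

end Summit.BirchSwinnertonDyer.BirchSwinnertonDyer.Theorems.GNineFrobeniusTrace

end
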